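import Literature.AlgebraicTopology.SingularHomology.RestrictionAcyclicComplement
import Literature.AlgebraicTopology.SingularHomology.UniversalCoefficientsField
import HarnessLib

/-!
# `H_q(X, X ∖ K; R) ≅ Hᵖ(K; R)` for a taut closed subset of a closed oriented manifold (Alexander–Lefschetz duality read in relative homology), and the rank bound for classes of `X ∖ K` dying in `X`

Let `X` be a closed `R`-oriented topological `n`-manifold (compact, Hausdorff, charted on `ℝⁿ`,
`μ : HomologicalOrientation R X n`), `K ⊆ X` closed with a tautness datum (Spanier 1966, Ch. 6
§1 Thm. 10; e.g. `K` compact and locally contractible: `Cech.RetractionNhds.nonempty_of_locallyContractibleSpace`),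
`U = X ∖ K` and `p + q = n`. This file PROVES, by composing the tree's PROVED dualities,

* `relativeSingularHomology.nonempty_linearEquiv_singularCohomology_of_retractionNhds` — **the
  `R`-linear isomorphism `H_q(X, U; R) ≅ Hᵖ(↥K; R)`**: H. Miller's Alexander–Lefschetz duality
  `- ⌢ [X]_K : Ȟᵖ(K) ≅ H_q(X | K) = H_q(X, X ∖ K)` (Lectures on Algebraic Topology (2020),
  Thm. 37.1 / Cor. 37.4 — the tree's `HomologicalOrientation.cechDuality_res`), the comparison of
  the two models of relative homology (`relativeSingularHomology.concreteIso`), and the tautness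
  `Ȟᵖ(K) ≅ Hᵖ(↥K)` (`Cech.RetractionNhds.cechEquiv`) — C. Voisin, *Hodge Theory II*, (1.7)–(1.9):
  "`Hᵏ(X, Y) ≅ lim_→ Hᵏ(X, V) = H_{2n-k}(U)`", here in the (equivalent, transposed) form with the
  roles of the open and the closed piece as in Hatcher Prop. 3.46: `H_q(X, X ∖ K) ≅ H^{n-q}(K)`;
* `relativeSingularHomology.finrank_ker_map_le` — over a FIELD and for `Hᵖ(↥K)` finite-dimensional:
  **the classes of `H_q(U)` dying in `H_q(X)` form a subspace of dimension `≤ dim Hᵖ(↥K)`**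
  (they are the image of the boundary `H_{q+1}(X, U) → H_q(U)` — exactness of the long exact
  sequence of the pair, Hatcher Thm. 2.16 — and `H_{q+1}(X, U) ≅ H^{p'}(↥K)`, `p' + q + 1 = n`);
* `relativeSingularHomology.map_surjective_of_isZero`, `singularCohomology.map_injective_of_map_surjective` —
  the bookkeeping "`H_q(X, U) = 0 ⇒ H_q(U) ↠ H_q(X)`" and "over a field, `f_*` onto in degree `q`
  ⇒ `f^*` one-to-one in degree `q`" (Kronecker duality, Hatcher §3.1 Thm. 3.2).

Everything is proved; no definitions, no named facts. Consumer: the cohomology of the Fermat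
hypersurfaces (`Literature/AlgebraicGeometry/HodgeTheory/Fermat*`), where `K = Z_k(ℂ)` is a
coordinate hyperplane section.

## References

* [Miller2020] H. Miller, Lectures on Algebraic Topology (2020), Def. 34.4, Lemma 34.5, Thm. 37.1,
  Cor. 37.4.
* [VoisinHodgeII2003] C. Voisin, Hodge Theory and Complex Algebraic Geometry II (CUP 2003), §1.2.2,
  proof of Thm. 1.23, (1.7)–(1.9).
* [HatcherAT2002] A. Hatcher, Algebraic Topology (CUP 2002), Thm. 2.16, §3.1 Thm. 3.2, §3.3
  Thm. 3.44, Prop. 3.46.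
* [Spanier1981] E. H. Spanier, Algebraic Topology (Springer 1981), Ch. 6 §1 Thm. 10.
-/

noncomputable section

open CategoryTheory Limits Set

universe u v

namespace Literature.AlgebraicTopology.SingularHomology

/-! ### Bookkeeping on the long exact sequence of a pair and on Kronecker duality -/

section Pair

variable {R : Type v} [CommRing R] {X : Type u} [TopologicalSpace X]

/-- **`H_q(A) → H_q(X)` is surjective when `H_q(X, A) = 0`** (exactness of
`H_q(A) → H_q(X) → H_q(X, A)`, Hatcher Thm. 2.16). [cite: HatcherAT2002, Thm. 2.16] -/
theorem relativeSingularHomology.map_surjective_of_isZero (A : Set X) (q : ℕ)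
    (hz : IsZero (relativeSingularHomology R R X A q)) :
    Function.Surjective (singularHomology.map R R
      (⟨Subtype.val, continuous_subtype_val⟩ : C(A, X)) q) := by
  have hex := relativeSingularHomology.exact_map_ofAbsolute R R A q
  rw [← ModuleCat.epi_iff_surjective]
  exact hex.epi_f (hz.eq_of_tgt _ _)

/-- **The classes of `H_q(A)` dying in `H_q(X)` are the boundaries**:
`ker (H_q(A) → H_q(X)) = im (∂ : H_{q+1}(X, A) → H_q(A))` (Hatcher Thm. 2.16).
[cite: HatcherAT2002, Thm. 2.16] -/
theorem relativeSingularHomology.ker_map_eq_range_δ (A : Set X) (q : ℕ) :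
    LinearMap.ker (singularHomology.map R R (⟨Subtype.val, continuous_subtype_val⟩ : C(A, X)) q).hom =
      LinearMap.range (relativeSingularHomology.δ R R X A q).hom := by
  have hex := relativeSingularHomology.exact_δ_map R R A q
  rw [ShortComplex.moduleCat_exact_iff_range_eq_ker] at hex
  exact hex.symm

/-- **Over a field, if `f_* : H_q(A; F) → H_q(B; F)` is onto then `f^* : H^q(B; F) → H^q(A; F)`
is one-to-one** (`⟨f^* c, z⟩ = ⟨c, f_* z⟩` and the Kronecker map `H^q → Hom(H_q, F)` is injective
over a field, Hatcher Thm. 3.2). [cite: HatcherAT2002, §3.1 Thm. 3.2] -/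
theorem singularCohomology.map_injective_of_map_surjective (F : Type v) [Field F]
    {A B : Type u} [TopologicalSpace A] [TopologicalSpace B] (f : C(A, B)) (q : ℕ)
    (hf : Function.Surjective (singularHomology.map F F f q)) :
    Function.Injective (singularCohomology.map F F f q) := by
  rw [injective_iff_map_eq_zero]
  intro c hc
  apply kroneckerPairing_injective_of_field F B q
  rw [map_zero]
  refine LinearMap.ext fun w ↦ ?_
  obtain ⟨z, rfl⟩ := hf w
  rw [LinearMap.zero_apply, ← kroneckerPairing_map, hc, LinearMap.map_zero₂]

end Pair

/-! ### `H_q(X, X ∖ K) ≅ Hᵖ(↥K)` on a closed oriented manifold -/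

section Manifold

variable {R : Type v} [CommRing R] {n : ℕ} {X : Type u} [TopologicalSpace X] [T2Space X]
  [CompactSpace X] [ChartedSpace (EuclideanSpace ℝ (Fin n)) X]

/-- **`H_q(X, X ∖ K; R) ≅ Hᵖ(↥K; R)`, `p + q = n`, for a closed subset `K` with a tautness datum
of a closed `R`-oriented `n`-manifold `X`**: the composite of the comparison of the two models of
`H_q(X, X ∖ K)` (`relativeSingularHomology.concreteIso`), the inverse of Miller's duality
`- ⌢ [X]_K : Ȟᵖ(K) ≅ H_q(X | K)` (Thm. 37.1 / Cor. 37.4, the tree's `cechDuality_res`) and the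
tautness isomorphism `Ȟᵖ(K) ≅ Hᵖ(↥K)` (Spanier Thm. 6.1.10, `Cech.RetractionNhds.cechEquiv`).
[cite: Miller2020, Thm. 37.1 and Cor. 37.4] [cite: HatcherAT2002, §3.3 Prop. 3.46]
[cite: Spanier1981, Ch. 6 §1, Thm. 10] -/
theorem relativeSingularHomology.nonempty_linearEquiv_singularCohomology_of_retractionNhds
    (μ : HomologicalOrientation R X n) {K : Set X} (hK : IsClosed K) (T : Cech.RetractionNhds K)
    {p q : ℕ} (h : p + q = n) :
    Nonempty (relativeSingularHomology R R X Kᶜ q ≃ₗ[R] singularCohomology R R (↥K) p) := by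
  have hγ := μ.res_fundamentalClass_point
  have hDK := μ.cechDuality_res hγ hK p q h
  let e₁ := LinearEquiv.ofBijective _ hDK
  let e₂ := (relativeSingularHomology.concreteIso R R X Kᶜ q).toLinearEquiv
  exact ⟨e₂.trans (e₁.symm.trans (T.cechEquiv R p))⟩

/-- **Rank form**: `H_q(X, X ∖ K; R)` is finite over `R` with the same rank as `Hᵖ(↥K; R)`,
whenever the latter is finite (`p + q = n`). [cite: Miller2020, Thm. 37.1 and Cor. 37.4]
[cite: HatcherAT2002, §3.3 Prop. 3.46] -/
theorem relativeSingularHomology.finite_and_finrank_eq_of_retractionNhds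
    (μ : HomologicalOrientation R X n) {K : Set X} (hK : IsClosed K) (T : Cech.RetractionNhds K)
    {p q : ℕ} (h : p + q = n) [Module.Finite R (singularCohomology R R (↥K) p)] :
    Module.Finite R (relativeSingularHomology R R X Kᶜ q) ∧
      Module.finrank R (relativeSingularHomology R R X Kᶜ q) =
        Module.finrank R (singularCohomology R R (↥K) p) := by
  obtain ⟨e⟩ := relativeSingularHomology.nonempty_linearEquiv_singularCohomology_of_retractionNhds
    μ hK T h
  exact ⟨Module.Finite.equiv e.symm, e.finrank_eq⟩

/-- **The classes of `H_q(X ∖ K)` dying in `H_q(X)` have rank `≤ dim Hᵖ(↥K)`, `p + q + 1 = n`**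
(over a field `F`, `Hᵖ(↥K; F)` finite-dimensional): they form the image of the boundary
`∂ : H_{q+1}(X, X ∖ K) → H_q(X ∖ K)` (Hatcher Thm. 2.16), and `H_{q+1}(X, X ∖ K) ≅ Hᵖ(↥K)`.
This is the numerical shadow of the Thom–Gysin / tube sequence
`Hᵖ(K) → H_q(X ∖ K) → H_q(X)` (Voisin II (1.7)–(1.9)). [cite: HatcherAT2002, Thm. 2.16 and §3.3 Prop. 3.46]
[cite: VoisinHodgeII2003, §1.2.2 proof of Thm. 1.23, (1.7)–(1.9)] -/
theorem relativeSingularHomology.finrank_ker_map_le {F : Type v} [Field F] {X : Type u}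
    [TopologicalSpace X] [T2Space X] [CompactSpace X] [ChartedSpace (EuclideanSpace ℝ (Fin n)) X]
    (μ : HomologicalOrientation F X n) {K : Set X} (hK : IsClosed K) (T : Cech.RetractionNhds K)
    {p q : ℕ} (h : p + (q + 1) = n) [Module.Finite F (singularCohomology F F (↥K) p)] :
    (LinearMap.ker (singularHomology.map F F
        (⟨Subtype.val, continuous_subtype_val⟩ : C(↥Kᶜ, X)) q).hom).FG ∧
      Module.finrank F (LinearMap.ker (singularHomology.map F F
        (⟨Subtype.val, continuous_subtype_val⟩ : C(↥Kᶜ, X)) q).hom) ≤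
        Module.finrank F (singularCohomology F F (↥K) p) := by
  obtain ⟨hfin, hrank⟩ := relativeSingularHomology.finite_and_finrank_eq_of_retractionNhds
    μ hK T h
  haveI := hfin
  rw [relativeSingularHomology.ker_map_eq_range_δ, ← hrank]
  exact ⟨Module.Finite.iff_fg.mp (Module.Finite.range (relativeSingularHomology.δ F F X Kᶜ q).hom),
    LinearMap.finrank_range_le _⟩

end Manifold

end Literature.AlgebraicTopology.SingularHomology

end
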